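import Literature.Probability.LatticeModels.GlauberTwoBlockGap
import Literature.Probability.LatticeModels.GibbsExistenceSummablePotential
import HarnessLib

/-!
# Strong mixing on cubes ⇒ a unique Gibbs measure: boundary flips as tilts and the DLR transfer
# ([Mar99] Theorem 2.7 (ii) ⇒ (i) via Lemma 2.8, and the uniqueness half of Theorem 3.3 (c)), PROVED

Topic `Literature/Probability/LatticeModels`; companion of `GlauberDynamicsStrongMixing.lean`,
`GlauberTwoBlockGap.lean` and `GlauberCovarianceDecay.lean` (same source, same vocabulary: `FRPotential`,
`FRPotential.spec`, `SMT`, `centeredCube`, `rOuterBoundary`, `rNeighbourhood`, `Glauber.spinFlip`).  Cell `ym-ir`,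
seat lit-3 (census rows B2/B4 of `pub/ym-ir/REDUCTION-CENSUS.md`).  Theorems only, plus one plumbing definition
with body (`Glauber.flipWeight`, [Mar99]'s `h_x = e^{−∇_x H}`); no named fact is introduced (D-0026).  This file is
the uniqueness step of the discharge of the named fact `Glauber.Martinelli1999_thm3_3` (Theorem 3.3 (b)+(c)):
`hasUniqueGibbsMeasure_of_SMT` turns the conclusion of `Glauber.Martinelli1999_SMT_of_uniformGap`
(`GlauberCovarianceDecay.lean`) into `HasUniqueGibbsMeasure (U.spec β)`.  SIBLING-SETTING result (finite-range
interactions, `±1` spins on `ℤ^d`); nothing here is a statement about gauge theories, and the Yang–Mills mass gap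
is not touched by it.

Source (held; locators = page files of `book:bertoin1999-lectures-probability-theory-statistics`):
[Mar99] F. Martinelli, *Lectures on Glauber dynamics for discrete spin models*, LNM 1717 (1999) 93–191: §2.2 the
DLR equations (2.2) and the finite-range Markov property; Theorem 2.7 (SM ⇔ SMT) p0158 L19–22; Lemma 2.8 (the
density `dμ_V^{τ^x}/dμ_V^τ` against the covariances of `e^{−∇_x H_U}`) p0160 L1–4 and the proof of (ii) ⇒ (i)
(2.14)–(2.15) p0160 L5–16; `h_x = e^{−∇_x H}` p0161 L5–8; Proposition 2.12 p0163 L41 and its proof p0164 L6–8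
(«a sequence of interpolating configurations `γ_i` … `γ_{i+1}` differs from `γ_i` at exactly one site», each
step a one-site density ratio controlled by `SMT`); Theorem 3.3 (c) p0170 L40–41 («there exists a unique Gibbs
measure»). [cite: Martinelli1999, Theorem 3.3]

## Contents

* `Glauber.flipWeight U β Λ y σ = exp(−β [H_Λ(σ^y) − H_Λ(σ)])`; `exists_flipWeight_bounds` (`R⁻¹ ≤ h_y ≤ R`,
  `R = e^{|β|M}` uniform in `Λ, y, σ`, from `exists_abs_hamiltonianIn_spinFlip_sub_le`: only interaction sets
  `X ∋ y` of diameter `≤ r` contribute to `∇_y H_Λ`); `dependsOn_flipWeight` (`h_y` reads only the `r`-ball at `y`).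
* `Glauber.integral_spec_spinFlip_mul` — **the boundary flip is a tilt**: for `y ∉ Λ` and `F` not reading the spin
  at `y`, `μ_Λ^{τ^y}(F) · μ_Λ^τ(h_y) = μ_Λ^τ(F h_y)` (unfolding the tree's `gibbsSpecOfPotential`:
  `glueWith Λ ζ (τ^y) = (glueWith Λ ζ τ)^y` and `e^{−βH(σ^y)} = e^{−βH(σ)} h_y(σ)`).
* `Glauber.abs_spec_real_spinFlip_sub_le` — under `SMT(Λ, l₀, α)` at `τ`:
  `|μ_Λ^{τ^y}(A) − μ_Λ^τ(A)| ≤ R² (2r+1)^d |Δ| e^{−α d(Δ, N_r(y))}` for `Δ`-local `A`, `Δ ⊆ Λ`, `d(Δ,N_r(y)) ≥ l₀`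
  (`= μ^τ(1_A; h_y)/μ^τ(h_y)`, covariance by `SMT`, denominator `≥ R⁻¹`).
* `Glauber.abs_spec_real_sub_le_boundary` — telescoping over `∂_r^+ Λ` after the Markov reduction
  (`FRPotential.spec_real_eq_of_agree`): `|μ_Λ^η(A) − μ_Λ^{η'}(A)| ≤ |∂_r^+ Λ| R² (2r+1)^d |Δ| e^{−αD}` whenever
  `l₀ ≤ D ≤ d(Δ, N_r(y))` for all `y ∈ ∂_r^+ Λ`.
* `Glauber.subsingleton_gibbsMeasures_of_SMT` — `SMT(B_L, l₀, α)` for all `L, τ` ⇒ `𝒢(γ)` has at most one element: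
  DLR transfer `|μ(A) − μ'(A)| ≤ sup_{η,η'} |μ_{B_L}^η(A) − μ_{B_L}^{η'}(A)| ≤ (2r+1)^d (2L+1)^d R² (2r+1)^d |Δ|
  e^{−α(L+1−r−L₀)} → 0` (`Δ ⊆ B_{L₀}`), then cylinders generate.
* `Glauber.gibbsMeasures_spec_nonempty` — existence (compactness + Feller, the tree's
  `gibbsMeasures_gibbsSpecOfPotential_nonempty`; local observables on `{±1}^{ℤ^d}` are continuous), and
  `Glauber.hasUniqueGibbsMeasure_of_SMT`.
* Geometry: `le_finsetSupDist_of_forall`, `exists_finsetSupDist_eq`, `exists_subset_centeredCube`,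
  `supDist_ge_of_mem_rOuterBoundary_centeredCube` (`d(B_{L₀}, N_r(y)) ≥ L+1−r−L₀` for `y ∈ ∂_r^+ B_L`),
  `card_rOuterBoundary_le`, `card_centeredCube`, `centeredCube_mono`.

## Faithfulness / deviations

[Mar99] obtains Theorem 3.3 (c) from part (a) (uniform exponential ergodicity in sup norm, via hypercontractivity)
and Theorem 3.1 (invariant measures of the infinite-volume dynamics = Gibbs measures, [L]).  Part (a) and the
infinite-volume semigroup are not typed in the tree; we reach (c) from (b) instead, by the printed mechanism of
§2.4 (Theorem 2.7 (ii) ⇒ (i), Lemma 2.8, proof of Proposition 2.12): a change of ONE boundary spin is a tilt by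
the local density `h_y`, whose effect on a distant local event is a covariance controlled by `SMT`; summing over
the `r`-boundary of `B_L` and letting `L → ∞` gives boundary-condition insensitivity, hence uniqueness by the DLR
equations — a genuinely shorter road in Lean with the same ingredients.  Existence («there exists») is the
standard compactness statement, taken from the tree.
-/

open MeasureTheory ProbabilityTheory Finset Filter
open scoped ENNReal Topology

noncomputable section

namespace Literature.Probability.LatticeModels

variable {d : ℕ}

/-! ### Geometry of cubes and boundaries -/

section Geometry

/-- A lower bound valid for all pairs is a lower bound for the ℓ^∞ distance of two nonempty finite sets.
[cite: Martinelli1999, §2.1] -/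
theorem le_finsetSupDist_of_forall {A B : Finset (Site d)} (hA : A.Nonempty) (hB : B.Nonempty) {n : ℕ}
    (h : ∀ x ∈ A, ∀ z ∈ B, n ≤ supDist x z) : n ≤ finsetSupDist A B := by
  unfold finsetSupDist
  have hne : (A ×ˢ B).Nonempty := Finset.nonempty_product.2 ⟨hA, hB⟩
  rw [dif_pos hne, Finset.le_inf'_iff]
  intro p hp
  obtain ⟨hp1, hp2⟩ := Finset.mem_product.1 hp
  exact h p.1 hp1 p.2 hp2

/-- Every finite set of sites lies in some centred cube `B_{L₀}`. [cite: Martinelli1999, §2.1] -/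
theorem exists_subset_centeredCube (Δ : Finset (Site d)) : ∃ L₀ : ℕ, Δ ⊆ centeredCube d L₀ := by
  classical
  refine ⟨Δ.sup fun x => Finset.univ.sup fun i => (x i).natAbs, fun x hx => mem_centeredCube.2 fun i => ?_⟩
  have h1 : (x i).natAbs ≤ Δ.sup fun x => Finset.univ.sup fun i => (x i).natAbs :=
    (Finset.le_sup (f := fun i => (x i).natAbs) (Finset.mem_univ i)).trans
      (Finset.le_sup (f := fun x : Site d => Finset.univ.sup fun i => (x i).natAbs) hx)
  constructor <;> omega

/-- **Distance from a small cube to the `r`-neighbourhood of an exterior boundary site of a big cube**: for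
`x ∈ B_{L₀}`, `y ∈ ∂_r^+ B_L` and `z` with `d(z,y) ≤ r`, `d(x,z) ≥ L + 1 − r − L₀`. [cite: Martinelli1999, §2.1] -/
theorem supDist_ge_of_mem_rOuterBoundary_centeredCube {r L L₀ : ℕ} {x y z : Site d}
    (hx : x ∈ centeredCube d L₀) (hy : y ∈ rOuterBoundary r (centeredCube d L))
    (hz : z ∈ rNeighbourhood r y) : L + 1 ≤ supDist x z + r + L₀ := by
  obtain ⟨hyL, -⟩ := mem_rOuterBoundary.1 hy
  rw [mem_centeredCube, not_forall] at hyL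
  obtain ⟨i, hi⟩ := hyL
  have hxi := (mem_centeredCube.1 hx) i
  have hzi := (supDist_le_iff.1 (mem_rNeighbourhood.1 hz)) i
  have h1 := natAbs_sub_le_supDist x z i
  omega

/-- `|∂_r^+ Λ| ≤ (2r+1)^d |Λ|`. [cite: Martinelli1999, §2.1] -/
theorem card_rOuterBoundary_le (r : ℕ) (Λ : Finset (Site d)) :
    (rOuterBoundary r Λ).card ≤ (2 * r + 1) ^ d * Λ.card := by
  unfold rOuterBoundary
  calc ((Λ.biUnion fun y => rNeighbourhood r y) \ Λ).card ≤ (Λ.biUnion fun y => rNeighbourhood r y).card :=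
        Finset.card_le_card Finset.sdiff_subset
    _ ≤ ∑ y ∈ Λ, (rNeighbourhood r y).card := Finset.card_biUnion_le
    _ = (2 * r + 1) ^ d * Λ.card := by
        rw [Finset.sum_congr rfl fun y _ => card_rNeighbourhood r y, Finset.sum_const, smul_eq_mul, mul_comm]

/-- `|B_L| = (2L+1)^d`. [cite: Martinelli1999, §2.1] -/
theorem card_centeredCube (d L : ℕ) : (centeredCube d L).card = (2 * L + 1) ^ d := by
  unfold centeredCube
  rw [Fintype.card_piFinset, Finset.prod_const, Finset.card_univ, Fintype.card_fin, Int.card_Icc]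
  congr 1
  omega

end Geometry

/-! ### Local observables on `{±1}^{ℤ^d}` are continuous -/

/-- An observable depending on finitely many `{±1}`-spins is continuous (for the product topology).
[folklore] -/
private theorem continuous_of_dependsOn_finset {A : Finset (Site d)} {f : (Site d → ℤˣ) → ℝ}
    (hf : DependsOn f (↑A : Set (Site d))) : Continuous f := by
  set g : (↥A → ℤˣ) → ℝ := fun ζ => f (glueWith A ζ fun _ => 1) with hg
  have hfg : f = g ∘ fun σ : Site d → ℤˣ => fun a : ↥A => σ a := by
    funext σ
    simp only [Function.comp, hg]
    exact hf fun x hx => (glueWith_apply_mem A (fun a : ↥A => σ a) (fun _ => 1) (Finset.mem_coe.1 hx)).symm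
  rw [hfg]
  exact continuous_of_discreteTopology.comp (continuous_pi fun a => continuous_apply (a : Site d))

namespace Glauber

variable {r : ℕ}

/-! ### Changing one boundary spin: the tilt by `e^{−β ∇_y H_Λ}` ([Mar99] Lemma 2.8, Theorem 2.7 (ii) ⇒ (i)) -/

section BoundaryFlip

/-- Gluing commutes with flipping an exterior spin. [cite: Martinelli1999, §2.1] -/
theorem glueWith_spinFlip (Λ : Finset (Site d)) {y : Site d} (hy : y ∉ Λ) (ζ : ↥Λ → ℤˣ)
    (τ : Site d → ℤˣ) : glueWith Λ ζ (spinFlip y τ) = spinFlip y (glueWith Λ ζ τ) := by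
  funext x
  rw [spinFlip_apply]
  by_cases hx : x ∈ Λ
  · rw [glueWith_apply_mem Λ ζ _ hx, if_neg, glueWith_apply_mem Λ ζ τ hx]
    rintro rfl
    exact hy hx
  · rw [glueWith_apply_not_mem Λ ζ _ hx, glueWith_apply_not_mem Λ ζ τ hx, spinFlip_apply,
      glueWith_apply_not_mem Λ ζ τ hy]

/-- **The boundary-flip weight** `h_y^Λ(σ) = exp(−β [H_Λ(σ^y) − H_Λ(σ)]) = e^{−β ∇_y H_Λ}(σ)` — the relative
density produced by flipping the spin at `y` ([Mar99]'s `h_x = exp(−∇_x H)` of Lemma 2.8 and the proof of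
Prop. 2.12). [cite: Martinelli1999, Lemma 2.8] -/
def flipWeight (U : FRPotential d ℤˣ r) (β : ℝ) (Λ : Finset (Site d)) (y : Site d) (σ : Site d → ℤˣ) : ℝ :=
  Real.exp (-β * (hamiltonianIn U.U (interactionSets r) Λ (spinFlip y σ) -
    hamiltonianIn U.U (interactionSets r) Λ σ))

/-- `h_y^Λ` is measurable. [cite: Martinelli1999, Lemma 2.8] -/
theorem measurable_flipWeight (U : FRPotential d ℤˣ r) (β : ℝ) (Λ : Finset (Site d)) (y : Site d) :
    Measurable (flipWeight U β Λ y) := by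
  have hmH : Measurable (hamiltonianIn U.U (interactionSets r) Λ) :=
    measurable_hamiltonianIn (fun A => (U.adapted A).2) _ Λ
  unfold flipWeight
  exact (((hmH.comp (measurable_spinFlip y)).sub hmH).const_mul _).exp

/-- `h_y^Λ > 0`. [cite: Martinelli1999, Lemma 2.8] -/
theorem flipWeight_pos (U : FRPotential d ℤˣ r) (β : ℝ) (Λ : Finset (Site d)) (y : Site d)
    (σ : Site d → ℤˣ) : 0 < flipWeight U β Λ y σ :=
  Real.exp_pos _

/-- **`∇_y H_Λ` is uniformly bounded**: `|H_Λ(σ^y) − H_Λ(σ)| ≤ 2 · 2^{(2r+1)^d} sup_X ‖U_X‖_∞` for all `Λ, y, σ`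
(only the interaction sets `X ∋ y` of diameter `≤ r` contribute). [cite: Martinelli1999, Lemma 2.8] -/
theorem exists_abs_hamiltonianIn_spinFlip_sub_le (U : FRPotential d ℤˣ r) :
    ∃ M : ℝ, 0 ≤ M ∧ ∀ (Λ : Finset (Site d)) (y : Site d) (σ : Site d → ℤˣ),
      |hamiltonianIn U.U (interactionSets r) Λ (spinFlip y σ) - hamiltonianIn U.U (interactionSets r) Λ σ| ≤ M := by
  classical
  obtain ⟨C, hC0, hC⟩ := U.exists_uniform_bound
  refine ⟨2 * C * (2 : ℝ) ^ (2 * r + 1) ^ d, by positivity, fun Λ y σ => ?_⟩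
  set F := (interactionSets r Λ).filter (fun A => (A ∩ Λ).Nonempty) with hF
  have hterm : ∀ A : Finset (Site d), |U.U A (spinFlip y σ) - U.U A σ| ≤
      if A ⊆ rNeighbourhood r y then 2 * C else 0 := by
    intro A
    split_ifs with hA
    · calc |U.U A (spinFlip y σ) - U.U A σ| ≤ |U.U A (spinFlip y σ)| + |U.U A σ| := abs_sub _ _
        _ ≤ C + C := add_le_add (hC A _) (hC A σ)
        _ = 2 * C := by ring
    · by_cases hyA : y ∈ A
      · obtain ⟨z, hzA, hz⟩ := Finset.not_subset.1 hA
        have hfar : r < supDist y z := by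
          rw [supDist_comm]
          exact not_le.1 fun h => hz (mem_rNeighbourhood.2 h)
        rw [U.range A ⟨y, hyA, z, hzA, hfar⟩]
        simp
      · have : U.U A (spinFlip y σ) = U.U A σ := (U.adapted A).1 fun x hx => by
          rw [spinFlip_apply, if_neg]
          rintro rfl
          exact hyA (Finset.mem_coe.1 hx)
        rw [this, sub_self, abs_zero]
  unfold hamiltonianIn
  rw [← hF, ← Finset.sum_sub_distrib]
  calc |∑ A ∈ F, (U.U A (spinFlip y σ) - U.U A σ)| ≤ ∑ A ∈ F, |U.U A (spinFlip y σ) - U.U A σ| :=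
        Finset.abs_sum_le_sum_abs _ _
    _ ≤ ∑ A ∈ F, (if A ⊆ rNeighbourhood r y then 2 * C else 0) := Finset.sum_le_sum fun A _ => hterm A
    _ = ∑ _A ∈ F.filter (fun A => A ⊆ rNeighbourhood r y), 2 * C := (Finset.sum_filter _ _).symm
    _ = ((F.filter (fun A => A ⊆ rNeighbourhood r y)).card : ℝ) * (2 * C) := by
        rw [Finset.sum_const, nsmul_eq_mul]
    _ ≤ (2 : ℝ) ^ (2 * r + 1) ^ d * (2 * C) := by
        refine mul_le_mul_of_nonneg_right ?_ (by positivity)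
        have h1 : F.filter (fun A => A ⊆ rNeighbourhood r y) ⊆ (rNeighbourhood r y).powerset :=
          fun A hA => Finset.mem_powerset.2 (Finset.mem_filter.1 hA).2
        have h2 := (Finset.card_le_card h1).trans_eq (by rw [Finset.card_powerset, card_rNeighbourhood])
        exact_mod_cast h2
    _ = 2 * C * (2 : ℝ) ^ (2 * r + 1) ^ d := by ring

/-- **Two-sided bounds on the flip weight**: `R⁻¹ ≤ h_y^Λ ≤ R` with `R = e^{|β| M} ≥ 1` uniform in `Λ, y, σ`.
[cite: Martinelli1999, Lemma 2.8] -/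
theorem exists_flipWeight_bounds (U : FRPotential d ℤˣ r) (β : ℝ) :
    ∃ R : ℝ, 1 ≤ R ∧ ∀ (Λ : Finset (Site d)) (y : Site d) (σ : Site d → ℤˣ),
      R⁻¹ ≤ flipWeight U β Λ y σ ∧ flipWeight U β Λ y σ ≤ R := by
  obtain ⟨M, hM0, hM⟩ := exists_abs_hamiltonianIn_spinFlip_sub_le U
  refine ⟨Real.exp (|β| * M), Real.one_le_exp (by positivity), fun Λ y σ => ?_⟩
  have h := hM Λ y σ
  have hb : |(-β) * (hamiltonianIn U.U (interactionSets r) Λ (spinFlip y σ) -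
      hamiltonianIn U.U (interactionSets r) Λ σ)| ≤ |β| * M := by
    rw [abs_mul, abs_neg]
    exact mul_le_mul_of_nonneg_left h (abs_nonneg _)
  obtain ⟨h1, h2⟩ := abs_le.1 hb
  unfold flipWeight
  constructor
  · rw [← Real.exp_neg]
    exact Real.exp_le_exp.2 h1
  · exact Real.exp_le_exp.2 h2

/-- **Locality of the flip weight**: `h_y^Λ` depends only on the spins within distance `r` of `y`.
[cite: Martinelli1999, Lemma 2.8] -/
theorem dependsOn_flipWeight (U : FRPotential d ℤˣ r) (β : ℝ) (Λ : Finset (Site d)) (y : Site d) :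
    DependsOn (flipWeight U β Λ y) (↑(rNeighbourhood r y) : Set (Site d)) := by
  classical
  intro σ σ' hσ
  unfold flipWeight hamiltonianIn
  rw [← Finset.sum_sub_distrib, ← Finset.sum_sub_distrib]
  congr 2
  refine Finset.sum_congr rfl fun A _ => ?_
  by_cases hyA : y ∈ A
  · by_cases hA : A ⊆ rNeighbourhood r y
    · have h1 : U.U A σ = U.U A σ' := (U.adapted A).1 fun x hx => hσ x (Finset.mem_coe.2 (hA (Finset.mem_coe.1 hx)))
      have h2 : U.U A (spinFlip y σ) = U.U A (spinFlip y σ') := (U.adapted A).1 fun x hx => by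
        rw [spinFlip_apply, spinFlip_apply]
        by_cases hxy : x = y
        · subst hxy
          rw [if_pos rfl, if_pos rfl, hσ x (Finset.mem_coe.2 (hA (Finset.mem_coe.1 hx)))]
        · rw [if_neg hxy, if_neg hxy, hσ x (Finset.mem_coe.2 (hA (Finset.mem_coe.1 hx)))]
      rw [h1, h2]
    · obtain ⟨z, hzA, hz⟩ := Finset.not_subset.1 hA
      have hfar : r < supDist y z := by
        rw [supDist_comm]
        exact not_le.1 fun h => hz (mem_rNeighbourhood.2 h)
      rw [U.range A ⟨y, hyA, z, hzA, hfar⟩]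
      simp
  · have key : ∀ θ : Site d → ℤˣ, U.U A (spinFlip y θ) = U.U A θ := fun θ =>
      (U.adapted A).1 fun x hx => by
        rw [spinFlip_apply, if_neg]
        rintro rfl
        exact hyA (Finset.mem_coe.1 hx)
    rw [key, key, sub_self, sub_self]

/-- **Flipping one boundary spin tilts the kernel by `h_y^Λ`** ([Mar99] Lemma 2.8 / proof of Thm 2.7,
`μ_Λ^{τ^y}(F) = μ_Λ^τ(F h_y)/μ_Λ^τ(h_y)`): for `y ∉ Λ` and an observable `F` not reading the spin at `y`,
`μ_Λ^{τ^y}(F) · μ_Λ^τ(h_y^Λ) = μ_Λ^τ(F h_y^Λ)`. [cite: Martinelli1999, Lemma 2.8] -/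
theorem integral_spec_spinFlip_mul (U : FRPotential d ℤˣ r) (β : ℝ) (Λ : Finset (Site d)) {y : Site d}
    (hy : y ∉ Λ) (τ : Site d → ℤˣ) {F : (Site d → ℤˣ) → ℝ} (hFm : Measurable F) {T : Set (Site d)}
    (hF : DependsOn F T) (hyT : y ∉ T) :
    (∫ ω, F ω ∂(U.spec β Λ (spinFlip y τ))) * ∫ ω, flipWeight U β Λ y ω ∂(U.spec β Λ τ) =
      ∫ ω, F ω * flipWeight U β Λ y ω ∂(U.spec β Λ τ) := by
  classical
  set H := hamiltonianIn U.U (interactionSets r) Λ with hH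
  have hmH : Measurable H := measurable_hamiltonianIn (fun A => (U.adapted A).2) _ Λ
  set φ : (Site d → ℤˣ) → ℝ := fun x => -β * H x with hφ
  have hφm : Measurable φ := hmH.const_mul _
  set ρ := flipWeight U β Λ y with hρ
  have hρm : Measurable ρ := measurable_flipWeight U β Λ y
  set π : Measure (↥Λ → ℤˣ) := Measure.pi fun _ => (Measure.count : Measure ℤˣ) with hπ
  set g : (↥Λ → ℤˣ) → (Site d → ℤˣ) := fun ζ => glueWith Λ ζ τ with hg
  set g' : (↥Λ → ℤˣ) → (Site d → ℤˣ) := fun ζ => glueWith Λ ζ (spinFlip y τ) with hg'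
  have hmg : Measurable g := measurable_glueWith Λ τ
  have hmg' : Measurable g' := measurable_glueWith Λ (spinFlip y τ)
  have hglue : ∀ ζ, g' ζ = spinFlip y (g ζ) := fun ζ => glueWith_spinFlip Λ hy ζ τ
  -- the two key pointwise facts
  have hexp : ∀ σ, Real.exp (φ (spinFlip y σ)) = Real.exp (φ σ) * ρ σ := fun σ => by
    rw [hρ, flipWeight, ← Real.exp_add]
    congr 1
    rw [hφ]
    ring
  have hFflip : ∀ σ, F (spinFlip y σ) = F σ := fun σ =>
    hF fun x hx => by
      rw [spinFlip_apply, if_neg]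
      rintro rfl
      exact hyT hx
  -- the tilted integrals as ratios over `π`
  have hrat : ∀ (G : (↥Λ → ℤˣ) → (Site d → ℤˣ)) (hG : Measurable G) {u : (Site d → ℤˣ) → ℝ}
      (hu : Measurable u),
      ∫ ω, u ω ∂((π.map G).tilted φ) = (∫ ζ, Real.exp (φ (G ζ)) * u (G ζ) ∂π) / ∫ ζ, Real.exp (φ (G ζ)) ∂π := by
    intro G hG u hu
    rw [integral_tilted_map_eq_integral_tilted_comp π hG hφm hu, integral_tilted]
    simp_rw [smul_eq_mul, div_mul_eq_mul_div]
    rw [integral_div]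
    rfl
  -- positivity of the normalisers
  haveI : NeZero π := ⟨fun h => map_glueWith_pi_ne_zero (Measure.count : Measure ℤˣ) (NeZero.ne _) Λ τ
    (by rw [← hπ, h, Measure.map_zero])⟩
  have hW : 0 < ∫ ζ, Real.exp (φ (g' ζ)) ∂π := integral_exp_pos (Integrable.of_finite)
  have hZ : 0 < ∫ ζ, Real.exp (φ (g ζ)) ∂π := integral_exp_pos (Integrable.of_finite)
  simp_rw [hglue, hexp] at hW
  change (∫ ω, F ω ∂((π.map g').tilted φ)) * ∫ ω, ρ ω ∂((π.map g).tilted φ) =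
    ∫ ω, F ω * ρ ω ∂((π.map g).tilted φ)
  rw [hrat g' hmg' hFm, hrat g hmg hρm, hrat g hmg (u := fun ω => F ω * ρ ω) (hFm.mul hρm)]
  simp_rw [hglue, hexp, hFflip]
  have hsym : ∀ ζ, Real.exp (φ (g ζ)) * ρ (g ζ) * F (g ζ) = Real.exp (φ (g ζ)) * (F (g ζ) * ρ (g ζ)) :=
    fun ζ => by ring
  simp_rw [hsym]
  field_simp

end BoundaryFlip

/-! ### SMT ⇒ insensitivity to the boundary condition ([Mar99] Thm 2.7 (ii) ⇒ (i), via Lemma 2.8) -/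

section Oscillation

/-- The attained ℓ^∞ distance of two nonempty finite sets. [cite: Martinelli1999, §2.1] -/
theorem exists_finsetSupDist_eq {A B : Finset (Site d)} (hA : A.Nonempty) (hB : B.Nonempty) :
    ∃ x ∈ A, ∃ z ∈ B, finsetSupDist A B = supDist x z := by
  unfold finsetSupDist
  have hne : (A ×ˢ B).Nonempty := Finset.nonempty_product.2 ⟨hA, hB⟩
  rw [dif_pos hne]
  obtain ⟨p, hp, hpeq⟩ := Finset.exists_mem_eq_inf' hne (fun p : Site d × Site d => supDist p.1 p.2)
  obtain ⟨hp1, hp2⟩ := Finset.mem_product.1 hp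
  exact ⟨p.1, hp1, p.2, hp2, hpeq⟩

/-- **One boundary flip moves a local probability by at most `R² (2r+1)^d |Δ| e^{−α d(Δ, N_r(y))}`** under
`SMT(Λ, l₀, α)` ([Mar99] Thm 2.7 (ii) ⇒ (i): `μ^{τ^y}(A) − μ^τ(A) = μ^τ(1_A; h_y)/μ^τ(h_y)`, the covariance is
controlled by `SMT` since `h_y` is supported in the `r`-ball at `y`, and `μ^τ(h_y) ≥ R⁻¹`).
[cite: Martinelli1999, Theorem 2.7] -/
theorem abs_spec_real_spinFlip_sub_le (U : FRPotential d ℤˣ r) (β : ℝ) {R : ℝ} (hR1 : 1 ≤ R)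
    (hR : ∀ (Λ : Finset (Site d)) (y : Site d) (σ : Site d → ℤˣ),
      R⁻¹ ≤ flipWeight U β Λ y σ ∧ flipWeight U β Λ y σ ≤ R)
    {Λ Δ : Finset (Site d)} (hΔΛ : Δ ⊆ Λ) {y : Site d} (hy : y ∉ Λ)
    {A : Set (Site d → ℤˣ)} (hA : MeasurableSet A) (hdA : DependsOn (· ∈ A) (↑Δ : Set (Site d)))
    {l₀ α : ℝ} (τ : Site d → ℤˣ) (hSMT : SMT (U.spec β) Λ l₀ α)
    (hdist : l₀ ≤ (finsetSupDist Δ (rNeighbourhood r y) : ℝ)) :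
    |(U.spec β Λ (spinFlip y τ)).real A - (U.spec β Λ τ).real A| ≤
      R ^ 2 * (2 * r + 1 : ℝ) ^ d * Δ.card *
        Real.exp (-(α * (finsetSupDist Δ (rNeighbourhood r y) : ℝ))) := by
  have hγ := U.isSpecification_spec β
  haveI := hγ.isProbability Λ τ
  haveI := hγ.isProbability Λ (spinFlip y τ)
  have hR0 : 0 < R := by linarith
  set ρ := flipWeight U β Λ y with hρ
  set f : (Site d → ℤˣ) → ℝ := A.indicator 1 with hf
  have hfm : Measurable f := measurable_one.indicator hA
  have hfdep : DependsOn f (↑Δ : Set (Site d)) := fun σ σ' h => by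
    have hiff : σ ∈ A ↔ σ' ∈ A := Iff.of_eq (hdA h)
    by_cases hσ : σ ∈ A
    · rw [hf, Set.indicator_of_mem hσ, Set.indicator_of_mem (hiff.1 hσ), Pi.one_apply, Pi.one_apply]
    · rw [hf, Set.indicator_of_notMem hσ, Set.indicator_of_notMem (fun h' => hσ (hiff.2 h'))]
  have hf1 : ∀ σ, |f σ| ≤ 1 := fun σ => by
    by_cases hσ : σ ∈ A
    · rw [hf, Set.indicator_of_mem hσ]; simp
    · rw [hf, Set.indicator_of_notMem hσ]; simp
  have hyΔ : y ∉ (↑Δ : Set (Site d)) := fun h => hy (hΔΛ (Finset.mem_coe.1 h))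
  have htilt := integral_spec_spinFlip_mul U β Λ hy τ hfm hfdep hyΔ
  have hρm : Measurable ρ := measurable_flipWeight U β Λ y
  have hρR : ∀ σ, |ρ σ| ≤ R := fun σ => by
    rw [abs_of_pos (flipWeight_pos U β Λ y σ)]
    exact (hR Λ y σ).2
  have hIρ : R⁻¹ ≤ ∫ ω, ρ ω ∂(U.spec β Λ τ) := by
    calc R⁻¹ = ∫ _ω, R⁻¹ ∂(U.spec β Λ τ) := by simp
      _ ≤ ∫ ω, ρ ω ∂(U.spec β Λ τ) :=
          integral_mono (integrable_const _)
            (Integrable.of_bound hρm.aestronglyMeasurable R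
              (Filter.Eventually.of_forall fun σ => by rw [Real.norm_eq_abs]; exact hρR σ))
            fun σ => (hR Λ y σ).1
  have hI : 0 < ∫ ω, ρ ω ∂(U.spec β Λ τ) := lt_of_lt_of_le (by positivity) hIρ
  have hcov := hSMT f ρ Δ (rNeighbourhood r y) 1 R hfm hρm hfdep (dependsOn_flipWeight U β Λ y) hf1 hρR
    hdist τ
  have h1 : (U.spec β Λ (spinFlip y τ)).real A = ∫ ω, f ω ∂(U.spec β Λ (spinFlip y τ)) := by
    rw [hf, integral_indicator_one hA]
  have h2 : (U.spec β Λ τ).real A = ∫ ω, f ω ∂(U.spec β Λ τ) := by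
    rw [hf, integral_indicator_one hA]
  rw [h1, h2]
  have key : ∫ ω, f ω ∂(U.spec β Λ (spinFlip y τ)) - ∫ ω, f ω ∂(U.spec β Λ τ) =
      (∫ ω, f ω * ρ ω ∂(U.spec β Λ τ) - (∫ ω, f ω ∂(U.spec β Λ τ)) * ∫ ω, ρ ω ∂(U.spec β Λ τ)) /
        ∫ ω, ρ ω ∂(U.spec β Λ τ) := by
    rw [eq_div_iff hI.ne', sub_mul, htilt]
  rw [key, abs_div, abs_of_pos hI]
  have hcard : ((rNeighbourhood r y).card : ℝ) = (2 * r + 1 : ℝ) ^ d := by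
    rw [card_rNeighbourhood]
    push_cast
    ring
  calc |∫ ω, f ω * ρ ω ∂(U.spec β Λ τ) - (∫ ω, f ω ∂(U.spec β Λ τ)) * ∫ ω, ρ ω ∂(U.spec β Λ τ)| /
        ∫ ω, ρ ω ∂(U.spec β Λ τ)
      ≤ ((Δ.card : ℝ) * (rNeighbourhood r y).card * 1 * R *
          Real.exp (-(α * (finsetSupDist Δ (rNeighbourhood r y) : ℝ)))) / R⁻¹ :=
        div_le_div₀ (by positivity) hcov (by positivity) hIρ
    _ = R ^ 2 * (2 * r + 1 : ℝ) ^ d * Δ.card *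
          Real.exp (-(α * (finsetSupDist Δ (rNeighbourhood r y) : ℝ))) := by
        rw [hcard]
        field_simp

/-- **SMT ⇒ the kernel forgets its boundary condition** (telescoping [Mar99] Thm 2.7 (ii) ⇒ (i) over the
`r`-boundary): for `Δ ⊆ Λ`, a `Δ`-local event `A`, `SMT(Λ, l₀, α)` for all boundary conditions, and
`l₀ ≤ D ≤ d(Δ, N_r(y))` for every `y ∈ ∂_r^+ Λ`,
`|μ_Λ^η(A) − μ_Λ^{η'}(A)| ≤ |∂_r^+ Λ| R² (2r+1)^d |Δ| e^{−α D}` for all `η, η'` (finite-range Markov property: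
only the spins on `∂_r^+ Λ` matter, and they are changed one at a time). [cite: Martinelli1999, Theorem 2.7] -/
theorem abs_spec_real_sub_le_boundary (U : FRPotential d ℤˣ r) (β : ℝ) {R : ℝ} (hR1 : 1 ≤ R)
    (hR : ∀ (Λ : Finset (Site d)) (y : Site d) (σ : Site d → ℤˣ),
      R⁻¹ ≤ flipWeight U β Λ y σ ∧ flipWeight U β Λ y σ ≤ R)
    {Λ Δ : Finset (Site d)} (hΔΛ : Δ ⊆ Λ) {A : Set (Site d → ℤˣ)} (hA : MeasurableSet A)
    (hdA : DependsOn (· ∈ A) (↑Δ : Set (Site d))) {l₀ α : ℝ} (hα : 0 ≤ α)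
    (hSMT : ∀ τ : Site d → ℤˣ, SMT (U.spec β) Λ l₀ α) {D : ℝ} (hl₀D : l₀ ≤ D)
    (hD : ∀ y ∈ rOuterBoundary r Λ, D ≤ (finsetSupDist Δ (rNeighbourhood r y) : ℝ))
    (η η' : Site d → ℤˣ) :
    |(U.spec β Λ η).real A - (U.spec β Λ η').real A| ≤
      (rOuterBoundary r Λ).card * (R ^ 2 * (2 * r + 1 : ℝ) ^ d * Δ.card * Real.exp (-(α * D))) := by
  classical
  set W := rOuterBoundary r Λ with hW
  set b : ℝ := R ^ 2 * (2 * r + 1 : ℝ) ^ d * Δ.card * Real.exp (-(α * D)) with hb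
  have hb0 : 0 ≤ b := by positivity
  -- finite-range Markov property: only the spins on `W` matter
  have hred : (U.spec β Λ η').real A = (U.spec β Λ (W.piecewise η' η)).real A :=
    U.spec_real_eq_of_agree β Λ hA hdA (fun x hx hxΛ => (hxΛ (hΔΛ (Finset.mem_coe.1 hx))).elim)
      fun x hx => (Finset.piecewise_eq_of_mem _ _ _ hx).symm
  -- one site at a time
  have hstep : ∀ (σ : Site d → ℤˣ) (y : Site d), y ∈ W → ∀ s : ℤˣ,
      |(U.spec β Λ (Function.update σ y s)).real A - (U.spec β Λ σ).real A| ≤ b := by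
    intro σ y hyW s
    have hyΛ : y ∉ Λ := (mem_rOuterBoundary.1 hyW).1
    by_cases hs : s = σ y
    · rw [hs, Function.update_eq_self, sub_self, abs_zero]
      exact hb0
    · have hflip : Function.update σ y s = spinFlip y σ := by
        funext z
        rw [Function.update_apply, spinFlip_apply]
        split_ifs with hz
        · exact Int.units_ne_iff_eq_neg.1 hs
        · rfl
      rw [hflip]
      refine (abs_spec_real_spinFlip_sub_le U β hR1 hR hΔΛ hyΛ hA hdA σ (hSMT σ)
        (hl₀D.trans (hD y hyW))).trans ?_
      rw [hb]
      gcongr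
      exact hD y hyW
  -- induction over the set of boundary sites already switched
  have hind : ∀ S : Finset (Site d), S ⊆ W →
      |(U.spec β Λ (S.piecewise η' η)).real A - (U.spec β Λ η).real A| ≤ S.card * b := by
    intro S
    induction S using Finset.induction_on with
    | empty =>
      intro _
      simp
    | insert y S hyS ih =>
      intro hS
      have hyW : y ∈ W := hS (Finset.mem_insert_self y S)
      have hS' : S ⊆ W := fun x hx => hS (Finset.mem_insert_of_mem hx)
      rw [Finset.piecewise_insert, Finset.card_insert_of_notMem hyS]
      calc |(U.spec β Λ (Function.update (S.piecewise η' η) y (η' y))).real A - (U.spec β Λ η).real A|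
          ≤ |(U.spec β Λ (Function.update (S.piecewise η' η) y (η' y))).real A -
              (U.spec β Λ (S.piecewise η' η)).real A| +
            |(U.spec β Λ (S.piecewise η' η)).real A - (U.spec β Λ η).real A| := abs_sub_le _ _ _
        _ ≤ b + S.card * b := add_le_add (hstep _ y hyW (η' y)) (ih hS')
        _ = ((S.card + 1 : ℕ) : ℝ) * b := by push_cast; ring
  rw [hred, abs_sub_comm]
  exact hind W Finset.Subset.rfl

end Oscillation

/-! ### From the kernels to the Gibbs measures: uniqueness and existence -/

section Uniqueness

/-- Two finite measures on `{±1}^{ℤ^d}` with the same mass that agree on all local (cylinder) events are equal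
(copy of the tree's private lemma of `DisagreementPercolationSubcritical.lean`). [folklore] -/
private theorem measure_eq_of_forall_local'' {μ ν : Measure (Site d → ℤˣ)} [IsFiniteMeasure μ]
    (huniv : μ Set.univ = ν Set.univ)
    (h : ∀ (Δ : Finset (Site d)) (A : Set (Site d → ℤˣ)), MeasurableSet A →
      DependsOn (· ∈ A) (↑Δ : Set (Site d)) → μ A = ν A) :
    μ = ν := by
  refine ext_of_generate_finite (measurableCylinders fun _ : Site d => ℤˣ)
    generateFrom_measurableCylinders.symm isPiSystem_measurableCylinders (fun s hs => ?_) huniv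
  obtain ⟨Δ, B, hB, rfl⟩ := (mem_measurableCylinders s).1 hs
  refine h Δ _ (MeasurableSet.cylinder Δ hB) fun σ τ hστ => ?_
  have hres : Δ.restrict σ = Δ.restrict τ := funext fun i => hστ i.1 (Finset.mem_coe.2 i.2)
  simp only [mem_cylinder, hres]

/-- **DLR transfer**: a uniform bound on the oscillation of the kernel `η ↦ γ_Λ^η(A)` bounds `|μ(A) − μ'(A)|` for
any two Gibbs measures (`μ(A) = ∫ γ_Λ^η(A) μ(dη)`). [cite: Martinelli1999, Theorem 3.3 (c)] -/
private theorem abs_real_sub_le_of_kernel {γ : Specification (Site d) ℤˣ} (hγ : IsSpecification γ)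
    {μ μ' : Measure (Site d → ℤˣ)} (hμ : IsGibbsMeasure γ μ) (hμ' : IsGibbsMeasure γ μ') (Λ : Finset (Site d))
    {A : Set (Site d → ℤˣ)} (hA : MeasurableSet A) {b : ℝ}
    (hker : ∀ η η' : Site d → ℤˣ, |(γ Λ η).real A - (γ Λ η').real A| ≤ b) :
    |μ.real A - μ'.real A| ≤ b := by
  haveI := hμ.isProbabilityMeasure
  haveI := hμ'.isProbabilityMeasure
  haveI : ∀ η, IsProbabilityMeasure (γ Λ η) := fun η => hγ.isProbability Λ η
  have hm : Measurable fun ω : Site d → ℤˣ => γ Λ ω A := (hγ.measurable Λ A hA).mono cylinderEvents_le_pi le_rfl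
  set g : (Site d → ℤˣ) → ℝ := fun ω => (γ Λ ω).real A with hg
  have hgm : Measurable g := hm.ennreal_toReal
  have hg1 : ∀ ω, |g ω| ≤ 1 := fun ω => by
    rw [hg]; dsimp only; rw [abs_of_nonneg measureReal_nonneg]; exact measureReal_le_one
  have dlr : ∀ {ν : Measure (Site d → ℤˣ)}, IsGibbsMeasure γ ν → ν.real A = ∫ ω, g ω ∂ν := by
    intro ν hν
    haveI := hν.isProbabilityMeasure
    rw [hg, measureReal_def, ← hν.2 Λ A hA]
    exact (integral_toReal hm.aemeasurable (ae_of_all _ fun ω => measure_lt_top (γ Λ ω) A)).symm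
  have hint : ∀ {ν : Measure (Site d → ℤˣ)} [IsProbabilityMeasure ν], Integrable g ν := fun {ν} _ =>
    (integrable_const (1 : ℝ)).mono' hgm.aestronglyMeasurable
      (ae_of_all _ fun ω => (Real.norm_eq_abs _).le.trans (hg1 ω))
  have key : ∀ {ν ν' : Measure (Site d → ℤˣ)} [IsProbabilityMeasure ν] [IsProbabilityMeasure ν'],
      ∫ ω, g ω ∂ν ≤ ∫ ω, g ω ∂ν' + b := by
    intro ν ν' _ _
    have h1 : ∀ η', ∫ ω, g ω ∂ν ≤ g η' + b := fun η' => by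
      calc ∫ ω, g ω ∂ν ≤ ∫ _, g η' + b ∂ν :=
            integral_mono hint (integrable_const _) fun ω => by
              have := hker ω η'; rw [abs_le] at this; dsimp only; linarith [this.2]
        _ = g η' + b := by rw [integral_const, probReal_univ, one_smul]
    have h2 : ∫ _, (∫ ω, g ω ∂ν) - b ∂ν' ≤ ∫ η', g η' ∂ν' :=
      integral_mono (integrable_const _) hint fun η' => by dsimp only; linarith [h1 η']
    rw [integral_const, probReal_univ, one_smul] at h2
    linarith
  rw [dlr hμ, dlr hμ', abs_le]
  constructor
  · linarith [key (ν := μ') (ν' := μ)]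
  · linarith [key (ν := μ) (ν' := μ')]

/-- Centred cubes increase with `L`. [cite: Martinelli1999, §2.1] -/
theorem centeredCube_mono {L₀ L : ℕ} (h : L₀ ≤ L) : centeredCube d L₀ ⊆ centeredCube d L := fun x hx =>
  mem_centeredCube.2 fun i => by
    have := (mem_centeredCube.1 hx) i
    omega

/-- The polynomial-times-exponential bound tends to zero: `(2L+1)^d e^{−α(L − c)} → 0`. [folklore] -/
private theorem tendsto_pow_mul_exp_neg {α : ℝ} (hα : 0 < α) (c K : ℝ) :
    Tendsto (fun L : ℕ => K * ((2 * (L : ℝ) + 1) ^ d * Real.exp (-(α * ((L : ℝ) - c))))) atTop (𝓝 0) := by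
  have hx : Tendsto (fun L : ℕ => α * (L : ℝ) + α / 2) atTop atTop :=
    tendsto_atTop_add_const_right _ _ (Tendsto.const_mul_atTop hα tendsto_natCast_atTop_atTop)
  have h0 := (Real.tendsto_pow_mul_exp_neg_atTop_nhds_zero d).comp hx
  have heq : (fun L : ℕ => K * ((2 * (L : ℝ) + 1) ^ d * Real.exp (-(α * ((L : ℝ) - c))))) =
      fun L : ℕ => (K * ((2 / α) ^ d * Real.exp (α * c + α / 2))) *
        ((α * (L : ℝ) + α / 2) ^ d * Real.exp (-(α * (L : ℝ) + α / 2))) := by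
    funext L
    have h1 : (2 * (L : ℝ) + 1) ^ d = (2 / α) ^ d * (α * (L : ℝ) + α / 2) ^ d := by
      rw [← mul_pow]
      congr 1
      field_simp
    have h2 : Real.exp (-(α * ((L : ℝ) - c))) = Real.exp (α * c + α / 2) * Real.exp (-(α * (L : ℝ) + α / 2)) := by
      rw [← Real.exp_add]
      congr 1
      ring
    rw [h1, h2]
    ring
  rw [heq]
  simpa using tendsto_const_nhds.mul h0

/-- **[Mar99] Theorem 3.3 (c), uniqueness half: `SMT` on all cubes, uniformly in the boundary condition, ⇒ at
most one Gibbs measure.**  For Gibbs `μ, μ'` and a `Δ`-local event `A`, `Δ ⊆ B_{L₀}`: by the DLR equations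
`|μ(A) − μ'(A)| ≤ sup_{η,η'} |μ_{B_L}^η(A) − μ_{B_L}^{η'}(A)| ≤ |∂_r^+ B_L| R² (2r+1)^d |Δ| e^{−α(L+1−r−L₀)} → 0`.
(The printed route goes through the exponential ergodicity (a) of the infinite-volume dynamics and Theorem 3.1;
here the boundary-condition insensitivity is obtained directly from (b), as in Theorem 2.7 (ii) ⇒ (i).)
[cite: Martinelli1999, Theorem 3.3 (c)] -/
theorem subsingleton_gibbsMeasures_of_SMT (U : FRPotential d ℤˣ r) (β : ℝ) {α l₀ : ℝ} (hα : 0 < α)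
    (hSMT : ∀ (L : ℕ) (τ : Site d → ℤˣ), SMT (U.spec β) (centeredCube d L) l₀ α) :
    (gibbsMeasures (U.spec β)).Subsingleton := by
  classical
  have hγ := U.isSpecification_spec β
  obtain ⟨R, hR1, hR⟩ := exists_flipWeight_bounds U β
  intro μ hμ μ' hμ'
  rw [mem_gibbsMeasures_iff] at hμ hμ'
  haveI := hμ.isProbabilityMeasure
  haveI := hμ'.isProbabilityMeasure
  refine measure_eq_of_forall_local'' (by rw [measure_univ, measure_univ]) fun Δ A hA hdA => ?_
  rcases Δ.eq_empty_or_nonempty with hΔe | hΔne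
  · -- a `∅`-local event is trivial
    subst hΔe
    have hconst : ∀ σ σ' : Site d → ℤˣ, σ ∈ A ↔ σ' ∈ A := fun σ σ' =>
      Iff.of_eq (hdA fun i hi => by simp at hi)
    by_cases hne : ∃ σ, σ ∈ A
    · obtain ⟨σ₀, hσ₀⟩ := hne
      have : A = Set.univ := Set.eq_univ_of_forall fun σ => (hconst σ₀ σ).1 hσ₀
      rw [this, measure_univ, measure_univ]
    · have : A = ∅ := Set.eq_empty_of_forall_notMem fun σ h => hne ⟨σ, h⟩
      rw [this, measure_empty, measure_empty]
  obtain ⟨L₀, hΔ⟩ := exists_subset_centeredCube Δ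
  set K : ℝ := (2 * r + 1 : ℝ) ^ d * (R ^ 2 * (2 * r + 1 : ℝ) ^ d * Δ.card) with hK
  -- the bound for large `L`
  have hbound : ∀ L : ℕ, L₀ ≤ L → l₀ ≤ (L : ℝ) + 1 - r - L₀ →
      |μ.real A - μ'.real A| ≤
        K * ((2 * (L : ℝ) + 1) ^ d * Real.exp (-(α * ((L : ℝ) - ((r : ℝ) + L₀ - 1))))) := by
    intro L hL₀ hl₀
    have hΔL : Δ ⊆ centeredCube d L := hΔ.trans (centeredCube_mono hL₀)
    set D : ℝ := (L : ℝ) + 1 - r - L₀ with hD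
    have hDy : ∀ y ∈ rOuterBoundary r (centeredCube d L), D ≤ (finsetSupDist Δ (rNeighbourhood r y) : ℝ) := by
      intro y hy
      have hN : (rNeighbourhood r y).Nonempty := ⟨y, mem_rNeighbourhood.2 (by simp)⟩
      obtain ⟨x, hx, z, hz, hxz⟩ := exists_finsetSupDist_eq hΔne hN
      have h := supDist_ge_of_mem_rOuterBoundary_centeredCube (hΔ hx) hy hz
      rw [hxz, hD]
      have h' : ((L + 1 : ℕ) : ℝ) ≤ ((supDist x z + r + L₀ : ℕ) : ℝ) := by exact_mod_cast h
      push_cast at h'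
      linarith
    have hker := abs_spec_real_sub_le_boundary U β hR1 hR hΔL hA hdA hα.le (hSMT L) hl₀ hDy
    refine (abs_real_sub_le_of_kernel hγ hμ hμ' _ hA fun η η' => hker η η').trans ?_
    have hcard : ((rOuterBoundary r (centeredCube d L)).card : ℝ) ≤ (2 * r + 1 : ℝ) ^ d * (2 * (L : ℝ) + 1) ^ d := by
      have := (card_rOuterBoundary_le r (centeredCube d L)).trans_eq (by rw [card_centeredCube])
      exact_mod_cast this
    have hDeq : -(α * D) = -(α * ((L : ℝ) - ((r : ℝ) + L₀ - 1))) := by rw [hD]; ring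
    rw [hDeq] at hker ⊢
    calc ((rOuterBoundary r (centeredCube d L)).card : ℝ) *
          (R ^ 2 * (2 * r + 1 : ℝ) ^ d * Δ.card * Real.exp (-(α * ((L : ℝ) - ((r : ℝ) + L₀ - 1)))))
        ≤ ((2 * r + 1 : ℝ) ^ d * (2 * (L : ℝ) + 1) ^ d) *
          (R ^ 2 * (2 * r + 1 : ℝ) ^ d * Δ.card * Real.exp (-(α * ((L : ℝ) - ((r : ℝ) + L₀ - 1))))) :=
          mul_le_mul_of_nonneg_right hcard (by positivity)
      _ = K * ((2 * (L : ℝ) + 1) ^ d * Real.exp (-(α * ((L : ℝ) - ((r : ℝ) + L₀ - 1))))) := by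
          rw [hK]; ring
  -- the limit
  have hlim := tendsto_pow_mul_exp_neg (d := d) hα ((r : ℝ) + L₀ - 1) K
  set L₁ : ℕ := L₀ + r + ⌈l₀⌉₊ with hL₁
  have hev : ∀ᶠ L : ℕ in atTop, |μ.real A - μ'.real A| ≤
      K * ((2 * (L : ℝ) + 1) ^ d * Real.exp (-(α * ((L : ℝ) - ((r : ℝ) + L₀ - 1))))) := by
    refine Filter.eventually_atTop.2 ⟨L₁, fun L hL => hbound L (by omega) ?_⟩
    have h1 : (L₁ : ℝ) ≤ L := by exact_mod_cast hL
    have h2 : l₀ ≤ ⌈l₀⌉₊ := Nat.le_ceil l₀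
    rw [hL₁] at h1
    push_cast at h1
    linarith
  have hle : |μ.real A - μ'.real A| ≤ 0 := ge_of_tendsto hlim hev
  have heq : μ.real A = μ'.real A := sub_eq_zero.1 (abs_eq_zero.1 (le_antisymm hle (abs_nonneg _)))
  exact (ENNReal.toReal_eq_toReal_iff' (measure_ne_top _ _) (measure_ne_top _ _)).1 heq

/-- **Existence of a Gibbs measure** for a finite-range potential with `±1` spins (compactness of `{±1}^{ℤ^d}` and
the Feller property of the Gibbsian kernels: the tree's `gibbsMeasures_gibbsSpecOfPotential_nonempty`,
Friedli–Velenik Thm 6.26 / Georgii Thm 4.17). [cite: Martinelli1999, §2.2] -/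
theorem gibbsMeasures_spec_nonempty (U : FRPotential d ℤˣ r) (β : ℝ) : (gibbsMeasures (U.spec β)).Nonempty := by
  unfold FRPotential.spec
  exact gibbsMeasures_gibbsSpecOfPotential_nonempty Measure.count U.adapted
    (fun A => continuous_of_dependsOn_finset (U.adapted A).1) U.bounded U.isSupportedBy β

/-- **[Mar99] Theorem 3.3 (c) from (b)**: `SMT(B_L, l₀, α)` for all `L` and all boundary conditions ⇒ there is
exactly one Gibbs measure. [cite: Martinelli1999, Theorem 3.3 (c)] -/
theorem hasUniqueGibbsMeasure_of_SMT (U : FRPotential d ℤˣ r) (β : ℝ) {α l₀ : ℝ} (hα : 0 < α)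
    (hSMT : ∀ (L : ℕ) (τ : Site d → ℤˣ), SMT (U.spec β) (centeredCube d L) l₀ α) :
    HasUniqueGibbsMeasure (U.spec β) :=
  ⟨subsingleton_gibbsMeasures_of_SMT U β hα hSMT, gibbsMeasures_spec_nonempty U β⟩

end Uniqueness

end Glauber

end Literature.Probability.LatticeModels

end
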